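import Summits.PneNP.PneNP.Theorems.ExpanderLinearGeneratorsColumnTwoBasic

/-!
# PneNP / ExpanderLinearGenerators — column weight two: a dense expanding core (Krivelevich's
extraction)

Route `PneNP/ExpanderLinearGenerators`, support for crux stmt-PneNP-11443. Krivelevich's theorem
("every locally sparse graph contains a linearly sized expander", SIAM J. Discrete Math. 32 (2018),
Theorem 1) in the weighted form needed here, with UNEVENLY spaced density thresholds
`θ_i = 0.498 + 1/(1000(i+1))` so that the final core keeps density `> 0.498` (hence strong expansion
of small sets) while still having cuts of relative size `1/(1000 (i+1)(i+2)) = Ω(1/log²)` at all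
scales. Given a boundaryless row set `C₀` with `|C₀| > r` in a scope family of column weight `≤ 2`
that is locally sparse (`8 e(W) ≤ Σ_{i∈W} |S i|` for `W ⊆ C₀`, `|W| ≤ r`):

* `exists_dense_core` — there are `U ⊆ C₀` and a level `i` (`2^i ≤ |C₀|`) with `|U| > r`, the
  TOUCHING property `θ_i · Σ_{W} |S ·| ≤ e(U) - e(U \\ W)` for every `W ⊆ U`, and the STOPPING
  property: no `W ⊆ U` with `r < |W| ≤ |U|/2` has density `≥ θ_{i+1}`.

References: M. Krivelevich, SIAM J. Discrete Math. 32 (2018) 611–623 (arXiv:1704.00465), Thm. 1 and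
its proof (§2).
-/

namespace Summit.PneNP.PneNP.Theorems.ColumnTwo

open Finset Literature.Computability.MetaComplexity

variable {ι : Type*} [Fintype ι] [DecidableEq ι] {S : ι → Finset ℕ}

/-- The thresholds decrease: `θ_{i+1} < θ_i`, in cross-multiplied form with the exact gap
`thetaNum i (i+2) = thetaNum (i+1) (i+1) + 1`. [folklore] -/
theorem thetaNum_succ_identity (i : ℕ) :
    thetaNum i * (i + 2) = thetaNum (i + 1) * (i + 1) + 1 := by
  unfold thetaNum; ring

/-- `8 θ_i > 1`: `thetaDen i < 8 thetaNum i`. [folklore] -/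
theorem thetaDen_lt (i : ℕ) : thetaDen i < 8 * thetaNum i := by
  unfold thetaNum thetaDen; omega

/-- **Krivelevich's extraction (weighted, uneven thresholds).** In a scope family of column weight
`≤ 2`, let `C₀` be a boundaryless row set with `|C₀| > r`, all of whose rows have nonempty scope,
which is locally sparse at scale `r`. Then some `U ⊆ C₀` with `|U| > r` and some level `i` with
`2^i ≤ |C₀|` satisfy: (touching) `thetaNum i · Σ_{k∈W} |S k| ≤ thetaDen i · (e(U) - e(U \\ W))` for
all `W ⊆ U`; (stopping) `thetaDen (i+1) · e(W) < thetaNum (i+1) · Σ_{k ∈ W} |S k|` for all `W ⊆ U`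
with `r < |W|` and `2|W| ≤ |U|`. [cite: Krivelevich2018LocallySparse, Theorem 1] -/
theorem exists_dense_core (hcw : ∀ v, coverDegree S Finset.univ v ≤ 2) {C₀ : Finset ι} {r : ℕ}
    (hcl : boundary S C₀ = ∅) (hr : r < C₀.card) (hdeg : ∀ k ∈ C₀, 0 < (S k).card)
    (hLS : ∀ W ⊆ C₀, W.card ≤ r → 8 * eIn S W ≤ ∑ k ∈ W, (S k).card) :
    ∃ U ⊆ C₀, ∃ i : ℕ, 2 ^ i ≤ C₀.card ∧ r < U.card ∧
      (∀ W ⊆ U, thetaNum i * ∑ k ∈ W, (S k).card ≤ thetaDen i * (eIn S U - eIn S (U \ W))) ∧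
      (∀ W ⊆ U, r < W.card → 2 * W.card ≤ U.card →
        thetaDen (i + 1) * eIn S W < thetaNum (i + 1) * ∑ k ∈ W, (S k).card) := by
  classical
  -- levels
  set P : ℕ → Prop := fun i => ∃ T ⊆ C₀, r < T.card ∧ 2 ^ i * T.card ≤ C₀.card ∧
    thetaNum i * ∑ k ∈ T, (S k).card ≤ thetaDen i * eIn S T with hP
  have hP0 : P 0 := by
    refine ⟨C₀, Finset.Subset.refl _, hr, by simp, ?_⟩
    have h := sum_card_eq hcw C₀
    rw [hcl, Finset.card_empty, zero_add] at h
    rw [h]; unfold thetaNum thetaDen; omega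
  have hPbound : ∀ i, P i → i < C₀.card := by
    rintro i ⟨T, -, hT, hTi, -⟩
    have h1 : 1 ≤ T.card := by omega
    have h2 : 2 ^ i ≤ C₀.card := le_trans (by simpa using Nat.mul_le_mul_left (2 ^ i) h1) hTi
    exact lt_of_lt_of_le (Nat.lt_two_pow_self) h2
  obtain ⟨i, hi, himax⟩ := Finset.exists_max_image ((Finset.range C₀.card).filter P) id
    ⟨0, Finset.mem_filter.2 ⟨Finset.mem_range.2 (by omega), hP0⟩⟩
  have hPi : P i := (Finset.mem_filter.1 hi).2
  have hnot : ¬ P (i + 1) := fun h => by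
    have := himax (i + 1) (Finset.mem_filter.2 ⟨Finset.mem_range.2 (hPbound _ h), h⟩)
    simp at this
  obtain ⟨T, hTC, hrT, hTi, hTdense⟩ := hPi
  -- the card-minimal dense nonempty subset of `T`
  set D := T.powerset.filter fun U => U.Nonempty ∧
    thetaNum i * ∑ k ∈ U, (S k).card ≤ thetaDen i * eIn S U with hD
  have hTD : T ∈ D := Finset.mem_filter.2
    ⟨Finset.mem_powerset.2 (Finset.Subset.refl _), Finset.card_pos.1 (by omega), hTdense⟩
  obtain ⟨U, hUD, hUmin⟩ := Finset.exists_min_image D Finset.card ⟨T, hTD⟩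
  obtain ⟨hUT, hUne, hUdense⟩ : U ⊆ T ∧ U.Nonempty ∧
      thetaNum i * ∑ k ∈ U, (S k).card ≤ thetaDen i * eIn S U := by
    have := Finset.mem_filter.1 hUD
    exact ⟨Finset.mem_powerset.1 this.1, this.2.1, this.2.2⟩
  have hUC : U ⊆ C₀ := hUT.trans hTC
  refine ⟨U, hUC, i, ?_, ?_, ?_, ?_⟩
  · have h1 : 1 ≤ T.card := by omega
    exact le_trans (by simpa using Nat.mul_le_mul_left (2 ^ i) h1) hTi
  · -- `|U| > r` by local sparsity
    by_contra hle
    push Not at hle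
    have h1 := hLS U hUC hle
    have h2 := thetaDen_lt i
    obtain ⟨k, hk⟩ := hUne
    have h3 : 0 < ∑ k ∈ U, (S k).card :=
      Finset.sum_pos' (fun _ _ => Nat.zero_le _) ⟨k, hk, hdeg k (hUC hk)⟩
    nlinarith
  · -- touching
    intro W hWU
    rcases W.eq_empty_or_nonempty with rfl | hWne
    · simp
    by_cases hWeq : W = U
    · subst hWeq
      simpa only [Finset.sdiff_self, eIn_empty, Nat.sub_zero] using hUdense
    have hne : (U \ W).Nonempty := Finset.sdiff_nonempty.2 fun h => hWeq (subset_antisymm hWU h)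
    have hlt : (U \ W).card < U.card := by
      have := Finset.card_sdiff_add_card_eq_card hWU
      have := Finset.card_pos.2 hWne
      omega
    have hnotD : U \ W ∉ D := fun h => absurd (hUmin _ h) (by omega)
    have hfail : thetaDen i * eIn S (U \ W) < thetaNum i * ∑ k ∈ U \ W, (S k).card := by
      by_contra hge
      push Not at hge
      exact hnotD (Finset.mem_filter.2
        ⟨Finset.mem_powerset.2 (Finset.sdiff_subset.trans hUT), hne, hge⟩)
    have hsum : ∑ k ∈ U, (S k).card = ∑ k ∈ W, (S k).card + ∑ k ∈ U \ W, (S k).card := by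
      rw [← Finset.sum_union Finset.disjoint_sdiff, Finset.union_sdiff_of_subset hWU]
    have hmono : eIn S (U \ W) ≤ eIn S U := eIn_mono Finset.sdiff_subset
    rw [hsum] at hUdense
    zify [hmono] at hUdense hfail ⊢
    nlinarith
  · -- stopping
    intro W hWU hrW h2W
    by_contra hge
    push Not at hge
    refine hnot ⟨W, hWU.trans hUC, hrW, ?_, hge⟩
    calc 2 ^ (i + 1) * W.card = 2 ^ i * (2 * W.card) := by ring
      _ ≤ 2 ^ i * U.card := Nat.mul_le_mul_left _ h2W
      _ ≤ 2 ^ i * T.card := Nat.mul_le_mul_left _ (Finset.card_le_card hUT)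
      _ ≤ C₀.card := hTi

end Summit.PneNP.PneNP.Theorems.ColumnTwo
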